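import Summits.CriticalPhenomena.PercolationContinuityZ3.Theorems.PercNearOneGluingNoHeavyQuantCombLevels
import Summits.CriticalPhenomena.PercolationContinuityZ3.Theorems.PercNearOneGluingNoHeavyQuantIndepLegsFarSub
import HarnessLib

/-!
# QUANT lane R8 — FAR on combs, base case: a comb all of whose hairs hang at the root is a spider

builds on p205010 (kernel theorem, internal audit signed; external expert review pending)

Support file (`--supports stmt-CriticalPhenomena-4575`), QUANT lane lead (gen 9), rung R8 of `run/shared/lean/prim/quant/LADDER.md`;
memo `prim-quant-lead-g9/LEAD-NOTES-G9.md` N20 step (5) — tenth file of the kernel proof of FAR (`Quant.FarTreeRow`) at EVERY layer on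
COMBS.  Setting of `…QuantCombLevels.lean`.  If every relay is either on the spine (`P z ⊆ P a`) or hangs at the root (`P z ∩ P a = ∅`),
the ancestor finsets are the prefix sets of a spider (one leg for the spine, one for each hair), and `Quant.far_indepLegs_sub`
(census-1 g6, p218880) gives the far-relay row.  Theorems only; no sorries; standard axioms.

* `Quant.farTree_comb_base` — `2j < Σ_{z∈A} T z` and `T a ≤ T z` on `A` imply `P(#{z ∈ A | P z open} ≤ j) ≤ 1 − T a` for such combs.
[this work; uses `Quant.far_indepLegs_sub`]
-/

noncomputable section

namespace Summit.CriticalPhenomena.PercolationContinuityZ3.Theorems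

namespace Quant

open Finset MeasureTheory
open Literature.Probability.LatticeModels
open Literature.Probability.Percolation
open scoped Classical

variable {ι : Type*} [Fintype ι]

/-- **FAR on combs, base case** (all hairs at the root): the configuration is a spider and `Quant.far_indepLegs_sub` applies. [this work] -/
theorem farTree_comb_base (q : ι → unitInterval) (P : ι → Finset ι) (A : Finset ι) (a : ι) (j : ℕ)
    (hsp : ∀ y ∈ P a, y ∈ P y ∧ P y ⊆ P a ∧ ∀ y' ∈ P a,
      (y ∈ P y' ∨ y' ∈ P y) ∧ (y ∈ P y' → P y ⊆ P y') ∧ (y ∈ P y' → y' ∈ P y → y = y'))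
    (hA6 : ∀ z ∈ A, ∀ z' ∈ A, z ≠ z' → Disjoint (P z \ P a) (P z' \ P a))
    (hA8 : ∀ z ∈ A, z ∈ P z)
    (hA9 : ∀ z ∈ A, ∏ y ∈ P a, (q y : ℝ) ≤ ∏ y ∈ P z, (q y : ℝ))
    (hmean : (2 * j : ℝ) < ∑ z ∈ A, ∏ y ∈ P z, (q y : ℝ))
    (h0 : ∀ z ∈ A, P z ⊆ P a ∨ P z ∩ P a = ∅) :
    (prodBernoulli q).real {ω : Set ι | (A.filter fun z => ((P z : Finset ι) : Set ι) ⊆ ω).card ≤ j} ≤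
      1 - ∏ y ∈ P a, (q y : ℝ) := by
  -- the hair through a non-spine gate (itself if none)
  set hairOf : ι → ι := fun y => if h : ∃ z, z ∈ A ∧ ¬ P z ⊆ P a ∧ y ∈ P z then Classical.choose h else y with hhair
  set leg : ι → Option ι := fun y => if y ∈ P a then none else some (hairOf y) with hleg
  set depth : ι → ℕ := fun y => if y ∈ P a then (P y).card else 0 with hdepth
  -- a non-spine gate of a hair determines the hair
  have huniq : ∀ {z y : ι}, z ∈ A → ¬ P z ⊆ P a → y ∈ P z → y ∉ P a → hairOf y = z := by
    intro z y hz hzs hyz hya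
    have hex : ∃ z, z ∈ A ∧ ¬ P z ⊆ P a ∧ y ∈ P z := ⟨z, hz, hzs, hyz⟩
    have hdef : hairOf y = Classical.choose hex := by simp only [hhair, dif_pos hex]
    obtain ⟨hz₀, hz₀s, hyz₀⟩ := Classical.choose_spec hex
    rw [hdef]
    by_contra hne
    exact Finset.disjoint_left.1 (hA6 _ hz₀ z hz hne) (Finset.mem_sdiff.2 ⟨hyz₀, hya⟩) (Finset.mem_sdiff.2 ⟨hyz, hya⟩)
  -- the spider prefix sets are the ancestor finsets (for any decidability instance)
  have hfilt : ∀ x ∈ A, ∀ (inst : DecidablePred fun y => leg y = leg x ∧ depth y ≤ depth x),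
      @Finset.filter ι (fun y => leg y = leg x ∧ depth y ≤ depth x) inst univ = P x := by
    intro x hx inst
    rcases h0 x hx with hxs | hxs
    · -- spine relay
      have hxa : x ∈ P a := hxs (hA8 x hx)
      have hlx : leg x = none := by simp only [hleg, if_pos hxa]
      have hdx : depth x = (P x).card := by simp only [hdepth, if_pos hxa]
      ext y
      rw [Finset.mem_filter, hlx, hdx]
      simp only [Finset.mem_univ, true_and]
      constructor
      · rintro ⟨hly, hdy⟩
        have hya : y ∈ P a := by
          by_contra h; simp only [hleg, if_neg h] at hly; exact Option.some_ne_none _ hly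
        simp only [hdepth, if_pos hya] at hdy
        exact (comb_spine_mem_iff_card_le P a hsp hya hxa).2 hdy
      · intro hy
        have hya : y ∈ P a := hxs hy
        refine ⟨by simp only [hleg, if_pos hya], ?_⟩
        simp only [hdepth, if_pos hya]
        exact (comb_spine_mem_iff_card_le P a hsp hya hxa).1 hy
    · -- hair at the root
      have hxna : x ∉ P a := fun h => Finset.notMem_empty x (hxs ▸ Finset.mem_inter.2 ⟨hA8 x hx, h⟩)
      have hxs' : ¬ P x ⊆ P a := fun h => hxna (h (hA8 x hx))
      have hlx : leg x = some x := by simp only [hleg, if_neg hxna, huniq hx hxs' (hA8 x hx) hxna]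
      have hdx : depth x = 0 := by simp only [hdepth, if_neg hxna]
      ext y
      rw [Finset.mem_filter, hlx, hdx]
      simp only [Finset.mem_univ, true_and, Nat.le_zero]
      constructor
      · rintro ⟨hly, -⟩
        have hya : y ∉ P a := by
          intro h; simp only [hleg, if_pos h] at hly; exact Option.some_ne_none x hly.symm
        simp only [hleg, if_neg hya, Option.some.injEq] at hly
        by_cases hex : ∃ z, z ∈ A ∧ ¬ P z ⊆ P a ∧ y ∈ P z
        · obtain ⟨-, -, hyz₀⟩ := Classical.choose_spec hex
          have : hairOf y = Classical.choose hex := by simp only [hhair, dif_pos hex]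
          rw [← hly, this]; exact hyz₀
        · have : hairOf y = y := by simp only [hhair, dif_neg hex]
          have hyx : y = x := by rw [← this]; exact hly
          rw [hyx]; exact hA8 x hx
      · intro hy
        have hya : y ∉ P a := fun h => Finset.notMem_empty y (hxs ▸ Finset.mem_inter.2 ⟨hy, h⟩)
        refine ⟨by simp only [hleg, if_neg hya, huniq hx hxs' hy hya], by simp only [hdepth, if_neg hya]⟩
  -- apply the spider theorem
  refine le_of_eq_of_le (Eq.symm ?_) (far_indepLegs_sub leg depth q A j (1 - ∏ y ∈ P a, (q y : ℝ)) ?_ ?_)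
  · congr 1
    ext ω
    simp only [Set.mem_setOf_eq]
    rw [Finset.filter_congr fun x hx => by rw [hfilt x hx]]
  · refine lt_of_lt_of_eq hmean (Finset.sum_congr rfl fun x hx => ?_)
    rw [hfilt x hx]
  · intro x hx
    rw [hfilt x hx]
    linarith [hA9 x hx]

end Quant

end Summit.CriticalPhenomena.PercolationContinuityZ3.Theorems

end
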